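import Summits.HodgeConjecture.CorCM.HodgeLieAlgebraReductive
import Summits.HodgeConjecture.CorCM.MumfordTateRankOfPowers
import Summits.HodgeConjecture.CorCM.MumfordTateRankFiveHodge
import Summits.HodgeConjecture.CorCM.MumfordTateRankThree
import Literature.AlgebraicGeometry.Motives.HodgeLieOfAbelianVarietySemisimpleTimesCM
import Literature.AlgebraicGeometry.HodgeTheory.NoTypeIVFactorProducts
import HarnessLib

/-!
# `dim MT(H¹(X₁ × X₂)) = dim MT(H¹X₁) + dim MT(H¹X₂) − 1` for `X₁` without factor of type IV and `X₂` of CM type;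
# the CM part of the semisimple-rank-one rungs: `dim MT(H¹(B^{m+1} × Z)) = dim MT(H¹Z) + 3`

COR-CM (cell `pub-hodgecm2`, seat `b27` gen 43, count-neutral Mumford–Tate-rank ladder; theorems only, no definition, no
named fact; UNCONDITIONAL — nothing here uses or asserts HC_CM).

Moonen–Zarhin's Thm. (3.2)(2) «`X₁` without factors of Type 4, `X₂` of CM-type ⟹ `Hg(X₁ × X₂) = Hg(X₁) × Hg(X₂)`»
(Math. Ann. 315 (1999) §3, after Hazama) is in the tree at the level of Hodge CLASSES (`NoTypeIVTimesCMProductSpan`,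
`NoTypeIVTimesCMStablyNondegenerate`: product span, condition (D)).  This file draws its LIE-ALGEBRA form — proved for
abstract polarizable Hodge structures in `Motives/HodgeLieSemisimpleTimesAbelian` and for bicones of complex abelian
varieties in `Motives/HodgeLieOfAbelianVarietySemisimpleTimesCM` — in the vocabulary of the Mumford–Tate-rank ladder
(`t(X) = dim MT(H¹X) = dim Lie Hg(H¹X) + 1`, `CorCM/MumfordTateRankEqHodgeLieRankAddOne`):

* §1 **`finrank_hodgeLie_hodge_one_eq_add_of_isIsogenous_prod`** — `X ∼ X₁ × X₂`, `X₁` without factor of type IV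
  (`HasNoTypeIVFactor`: `Lie Hg(H¹X₁) ∩ End⁰ = 0`, `hodgeLie_hodge_one_inf_endAlg_eq_bot_of_hasNoTypeIVFactor`), `X₂` of
  CM type (`[Lie Hg, Lie Hg] = 0`, `isOfCMType_iff_hodgeLie_derived_eq_bot`) ⟹
  `dim Lie Hg(H¹X) = dim Lie Hg(H¹X₁) + dim Lie Hg(H¹X₂)`; **`mtRank_hodge_one_add_one_eq_add_of_isIsogenous_prod`** —
  `t(X) + 1 = t(X₁) + t(X₂)`.
* §2 powers: **`finrank_hodgeLie_hodge_one_eq_add_of_isIsogenous_powSucc_prod`** — `X ∼ B^{m+1} × Z` (`B` without factor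
  of type IV, `Z` of CM type) ⟹ `dim Lie Hg(H¹X) = dim Lie Hg(H¹B) + dim Lie Hg(H¹Z)` (`Hg(B^{m+1}) = Hg(B)`, gen 42);
  `t(X) + 1 = t(B) + t(Z)`.
* §3 THE CM PART OF THE SEMISIMPLE-RANK-ONE RUNGS (converse / uniqueness for `CorCM/MumfordTateRankSixCMRank`): for `B`
  a SIMPLE non-CM curve or QM surface (`0 < dim B ≤ 2`, `dim_ℚ End⁰B = (dim B)²`, `Z(End⁰B) = ℚ`) and ANY `Z` of CM type,
  **`finrank_hodgeLie_hodge_one_eq_three_add_of_isIsogenous_powSucc_prod`** — `dim Lie Hg(H¹X) = 3 + dim Lie Hg(H¹Z)`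
  for every `X ∼ B^{m+1} × Z`, and **`mtRank_hodge_one_eq_add_three_of_isIsogenous_powSucc_prod`** —
  `t(X) = t(Z) + 3` when `0 < dim Z` (the tree had only `≤`, `finrank_hodgeLie_hodge_one_le_add_of_isIsogenous_powSucc_prod`,
  and the equality for `Z` the CM part PRODUCED by the splitting; now it holds for every CM complement, so the CM part of
  the rungs `t ≤ 6`, and of the rank-one part of `t = 7`, is determined up to the value of `dim Hg(Z) = t − 4`).

## References
* [MoonenZarhin1999LowDim] B. Moonen, Yu. Zarhin, *Hodge classes on abelian varieties of low dimension*, Math. Ann. 315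
  (1999), §3 (3.1), Thm. (3.2)(2) [corpus: paper:arxiv-math_9901113 p. 6]; §2 (2.2)–(2.3).
* [Hazama1989] F. Hazama, *Algebraic cycles on nonsimple abelian varieties*, Duke Math. J. 58 (1989) 31–37.
* [Deligne1982HodgeCycles] P. Deligne, *Hodge cycles on abelian varieties*, LNM 900 (1982), I §3.1, Prop. 3.4, Prop. 3.6.
* [MumfordAV1970] D. Mumford, *Abelian Varieties* (1970), §19 Thm. 1, Cor. 1–2.
-/

noncomputable section

open CategoryTheory CategoryTheory.Limits Module

namespace Summit.HodgeConjecture.CorCM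

open Literature.AlgebraicGeometry.Motives
open Literature.AlgebraicGeometry.Motives.AbelianVariety
open Literature.AlgebraicGeometry.Motives.HodgeStructure
open Literature.AlgebraicGeometry.HodgeTheory
open Literature.AlgebraicGeometry.Milne1999 (IsOfCMType isOfCMType_prod_iff isOfCMType_powSucc_iff isOfCMType_iff_of_isIsogenous)
open Literature.AlgebraicGeometry.Pohlmann1968 (isIsogenous_powSucc_biproduct)

variable [HodgeTensorFacts.{0, 0}] {X : AbelianVariety ℂ} {n : ℕ}

/-! ### §1 `X ∼ X₁ × X₂`, `X₁` without factor of type IV, `X₂` of CM type -/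

/-- The Hodge Lie algebra of a CM abelian variety is commutative (`[Lie Hg, Lie Hg] = 0`,
`isOfCMType_iff_hodgeLie_derived_eq_bot`). [cite: MoonenZarhin1999LowDim, §1] [cite: Deligne1982HodgeCycles, I Prop. 3.6] -/
theorem hodgeLie_hodge_one_comm_of_isOfCMType {Z : AbelianVariety ℂ} {k : ℕ} (hZ : IsSmoothProjective k Z.X)
    (hcm : IsOfCMType Z) :
    haveI := BettiUniverse.finite hZ 1
    ∀ A ∈ (BettiUniverse.hodge exists_isReal_hodgeModel_holds hZ 1).hodgeLie,
      ∀ B ∈ (BettiUniverse.hodge exists_isReal_hodgeModel_holds hZ 1).hodgeLie, A * B = B * A := by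
  haveI := BettiUniverse.finite hZ 1
  intro A hA B hB
  have hder := (isOfCMType_iff_hodgeLie_derived_eq_bot hZ).1 hcm
  have hmem : A * B - B * A ∈ Submodule.span ℚ {C | ∃ X' ∈ (BettiUniverse.hodge exists_isReal_hodgeModel_holds hZ 1).hodgeLie,
      ∃ Y ∈ (BettiUniverse.hodge exists_isReal_hodgeModel_holds hZ 1).hodgeLie, X' * Y - Y * X' = C} :=
    Submodule.subset_span ⟨A, hA, B, hB, rfl⟩
  rw [hder, Submodule.mem_bot] at hmem
  exact sub_eq_zero.1 hmem

/-- **`dim Lie Hg(H¹X) = dim Lie Hg(H¹X₁) + dim Lie Hg(H¹X₂)` for `X ∼ X₁ × X₂` with `X₁` WITHOUT FACTOR OF TYPE IV and `X₂`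
OF CM TYPE** — Moonen–Zarhin Thm. (3.2)(2) «`Hg(X₁ × X₂) = Hg(X₁) × Hg(X₂)`» for the Lie algebras, without condition (D)
(`AbelianVariety.finrank_hodgeLie_hodge_one_eq_add_of_isIsogenous_prod` with `Lie Hg(H¹X₁) ∩ End⁰ = 0` from
`hodgeLie_hodge_one_inf_endAlg_eq_bot_of_hasNoTypeIVFactor` and `Lie Hg(H¹X₂)` commutative).
[cite: MoonenZarhin1999LowDim, §3 Thm. (3.2)(2)] [cite: Hazama1989, Thm. (= Gordon 7.6.2)] -/
theorem finrank_hodgeLie_hodge_one_eq_add_of_isIsogenous_prod (hX : IsSmoothProjective n X.X) {X₁ X₂ : AbelianVariety ℂ}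
    {n₁ n₂ : ℕ} (hX₁ : IsSmoothProjective n₁ X₁.X) (hX₂ : IsSmoothProjective n₂ X₂.X) (hA4 : HasNoTypeIVFactor X₁)
    (hcm : IsOfCMType X₂) (h : IsIsogenous X (X₁.prod X₂)) :
    haveI := BettiUniverse.finite hX 1
    haveI := BettiUniverse.finite hX₁ 1
    haveI := BettiUniverse.finite hX₂ 1
    Module.finrank ℚ (BettiUniverse.hodge exists_isReal_hodgeModel_holds hX 1).hodgeLie =
      Module.finrank ℚ (BettiUniverse.hodge exists_isReal_hodgeModel_holds hX₁ 1).hodgeLie +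
        Module.finrank ℚ (BettiUniverse.hodge exists_isReal_hodgeModel_holds hX₂ 1).hodgeLie :=
  AbelianVariety.finrank_hodgeLie_hodge_one_eq_add_of_isIsogenous_prod hX hX₁ hX₂ h
    (hodgeLie_hodge_one_inf_endAlg_eq_bot_of_hasNoTypeIVFactor hX₁ hA4) (hodgeLie_hodge_one_comm_of_isOfCMType hX₂ hcm)

/-- **`t(X) + 1 = t(X₁) + t(X₂)`** (`t = dim MT(H¹·)`) **for `X ∼ X₁ × X₂` with `X₁` without factor of type IV and `X₂`
of CM type**, both of positive dimension (`dim MT = dim Lie Hg + 1`, `mtRank_hodge_one_eq_finrank_hodgeLie_add_one`).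
[cite: MoonenZarhin1999LowDim, §3 Thm. (3.2)(2)] [cite: Deligne1982HodgeCycles, I §3.1 and Prop. 3.4] -/
theorem mtRank_hodge_one_add_one_eq_add_of_isIsogenous_prod (hX : IsSmoothProjective n X.X) {X₁ X₂ : AbelianVariety ℂ}
    {n₁ n₂ : ℕ} (hX₁ : IsSmoothProjective n₁ X₁.X) (hX₂ : IsSmoothProjective n₂ X₂.X) (h₁ : 0 < X₁.dim) (h₂ : 0 < X₂.dim)
    (hA4 : HasNoTypeIVFactor X₁) (hcm : IsOfCMType X₂) (h : IsIsogenous X (X₁.prod X₂)) :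
    haveI := BettiUniverse.finite hX 1
    haveI := BettiUniverse.finite hX₁ 1
    haveI := BettiUniverse.finite hX₂ 1
    (BettiUniverse.hodge exists_isReal_hodgeModel_holds hX 1).mtRank + 1 =
      (BettiUniverse.hodge exists_isReal_hodgeModel_holds hX₁ 1).mtRank +
        (BettiUniverse.hodge exists_isReal_hodgeModel_holds hX₂ 1).mtRank := by
  have h0 : 0 < X.dim := by
    obtain ⟨f, hf⟩ := h
    rw [dim_eq_of_isIsogeny hf, dim_prod]; omega
  rw [mtRank_hodge_one_eq_finrank_hodgeLie_add_one hX h0, mtRank_hodge_one_eq_finrank_hodgeLie_add_one hX₁ h₁,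
    mtRank_hodge_one_eq_finrank_hodgeLie_add_one hX₂ h₂,
    finrank_hodgeLie_hodge_one_eq_add_of_isIsogenous_prod hX hX₁ hX₂ hA4 hcm h]
  ring

/-! ### §2 `X ∼ B^{m+1} × Z` -/

/-- **`dim Lie Hg(H¹X) = dim Lie Hg(H¹B) + dim Lie Hg(H¹Z)` for `X ∼ B^{m+1} × Z`, `B` without factor of type IV, `Z` of CM
type** (`B^{m+1}` has no factor of type IV, `HasNoTypeIVFactor.powSucc`; `dim Lie Hg(H¹(B^{m+1})) = dim Lie Hg(H¹B)`,
`AbelianVariety.finrank_hodgeLie_hodge_one_eq_of_isIsogenous_biproduct_const`). [cite: MoonenZarhin1999LowDim, §3 Thm. (3.2)(2)]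
[cite: MoonenZarhin1999LowDim, §1] -/
theorem finrank_hodgeLie_hodge_one_eq_add_of_isIsogenous_powSucc_prod (hX : IsSmoothProjective n X.X)
    {B Z : AbelianVariety ℂ} {k l : ℕ} (hB : IsSmoothProjective k B.X) (hZ : IsSmoothProjective l Z.X)
    (hA4 : HasNoTypeIVFactor B) (hcm : IsOfCMType Z) {m : ℕ} (h : IsIsogenous X ((B.powSucc m).prod Z)) :
    haveI := BettiUniverse.finite hX 1
    haveI := BettiUniverse.finite hB 1
    haveI := BettiUniverse.finite hZ 1
    Module.finrank ℚ (BettiUniverse.hodge exists_isReal_hodgeModel_holds hX 1).hodgeLie =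
      Module.finrank ℚ (BettiUniverse.hodge exists_isReal_hodgeModel_holds hB 1).hodgeLie +
        Module.finrank ℚ (BettiUniverse.hodge exists_isReal_hodgeModel_holds hZ 1).hodgeLie := by
  have hP : IsSmoothProjective (B.powSucc m).dim (B.powSucc m).X := AbelianVariety.isSmoothProjective_holds
  rw [finrank_hodgeLie_hodge_one_eq_add_of_isIsogenous_prod hX hP hZ (hA4.powSucc m) hcm h,
    AbelianVariety.finrank_hodgeLie_hodge_one_eq_of_isIsogenous_biproduct_const hB hP
      (isIsogenous_powSucc_biproduct B m)]

/-- **`t(X) + 1 = t(B) + t(Z)` for `X ∼ B^{m+1} × Z`**, `B` without factor of type IV, `Z` of CM type, `0 < dim B`,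
`0 < dim Z`. [cite: MoonenZarhin1999LowDim, §3 Thm. (3.2)(2)] [cite: MoonenZarhin1999LowDim, §1] -/
theorem mtRank_hodge_one_add_one_eq_add_of_isIsogenous_powSucc_prod (hX : IsSmoothProjective n X.X)
    {B Z : AbelianVariety ℂ} {k l : ℕ} (hB : IsSmoothProjective k B.X) (hZ : IsSmoothProjective l Z.X)
    (hB0 : 0 < B.dim) (hZ0 : 0 < Z.dim) (hA4 : HasNoTypeIVFactor B) (hcm : IsOfCMType Z) {m : ℕ}
    (h : IsIsogenous X ((B.powSucc m).prod Z)) :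
    haveI := BettiUniverse.finite hX 1
    haveI := BettiUniverse.finite hB 1
    haveI := BettiUniverse.finite hZ 1
    (BettiUniverse.hodge exists_isReal_hodgeModel_holds hX 1).mtRank + 1 =
      (BettiUniverse.hodge exists_isReal_hodgeModel_holds hB 1).mtRank +
        (BettiUniverse.hodge exists_isReal_hodgeModel_holds hZ 1).mtRank := by
  have h0 : 0 < X.dim := by
    obtain ⟨f, hf⟩ := h
    rw [dim_eq_of_isIsogeny hf, dim_prod, dim_powSucc]; positivity
  rw [mtRank_hodge_one_eq_finrank_hodgeLie_add_one hX h0, mtRank_hodge_one_eq_finrank_hodgeLie_add_one hB hB0,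
    mtRank_hodge_one_eq_finrank_hodgeLie_add_one hZ hZ0,
    finrank_hodgeLie_hodge_one_eq_add_of_isIsogenous_powSucc_prod hX hB hZ hA4 hcm h]
  ring

/-! ### §3 The CM part of the semisimple-rank-one rungs: `t(B^{m+1} × Z) = t(Z) + 3` -/

section RankOne

variable {B Z : AbelianVariety ℂ} {m : ℕ}

/-- **A simple non-CM complex abelian variety `B` with `0 < dim B ≤ 2`, `dim_ℚ End⁰B = (dim B)²` and `Z(End⁰B) = ℚ` (a
non-CM elliptic curve or a QM abelian surface) has `dim_ℚ Lie Hg(H¹B) = 3`** (`Hg(B) = SL₂`-type): `≤ 3` is the tree's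
`not_le_endAlg_and_finrank_hodgeLie_le_three_of_factor`, `≥ 3` is `4 ≤ dim MT(H¹B)` for non-CM `B`
(`four_le_mtRank_hodge_one_of_not_isOfCMType`). [cite: MoonenZarhin1999LowDim, §2 (2.2)–(2.3)]
[cite: MumfordAV1970, §19 Thm. 1, Cor. 1–2 (pp. 173–174)] -/
theorem finrank_hodgeLie_hodge_one_eq_three_of_factor (hBs : B.IsSimple) (hB0 : 0 < B.dim) (hB2 : B.dim ≤ 2)
    (hBcm : ¬ IsOfCMType B) (hfinB : Module.finrank ℚ B.endAlgebra = B.dim ^ 2) :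
    haveI := BettiUniverse.finite (AbelianVariety.isSmoothProjective_holds (A := B)) 1
    Module.finrank ℚ (BettiUniverse.hodge exists_isReal_hodgeModel_holds
      (AbelianVariety.isSmoothProjective_holds (A := B)) 1).hodgeLie = 3 := by
  haveI := BettiUniverse.finite (AbelianVariety.isSmoothProjective_holds (A := B)) 1
  obtain ⟨-, h3⟩ := not_le_endAlg_and_finrank_hodgeLie_le_three_of_factor hBs hB0 hBcm hfinB hB2
  have h4 := four_le_mtRank_hodge_one_of_not_isOfCMType (AbelianVariety.isSmoothProjective_holds (A := B)) hBcm
  rw [mtRank_hodge_one_eq_finrank_hodgeLie_add_one (AbelianVariety.isSmoothProjective_holds (A := B)) hB0] at h4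
  omega

/-- **`dim Lie Hg(H¹X) = 3 + dim Lie Hg(H¹Z)` for EVERY `X ∼ B^{m+1} × Z` with `B` a simple non-CM curve or QM surface
(`0 < dim B ≤ 2`, `dim End⁰B = (dim B)²`, `dim Z(End⁰B) = 1`) and `Z` of CM type** — the CM part of the semisimple-rank-one
splitting `Hg = SL₂ · T` is determined: `dim T = dim Lie Hg(H¹Z)` (the tree had `≤`,
`finrank_hodgeLie_hodge_one_le_add_of_isIsogenous_powSucc_prod`). [cite: MoonenZarhin1999LowDim, §3 Thm. (3.2)(2)]
[cite: MoonenZarhin1999LowDim, §2 (2.2)–(2.3)] -/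
theorem finrank_hodgeLie_hodge_one_eq_three_add_of_isIsogenous_powSucc_prod (hX : IsSmoothProjective n X.X)
    (hBs : B.IsSimple) (hB0 : 0 < B.dim) (hB2 : B.dim ≤ 2) (hBcm : ¬ IsOfCMType B)
    (hfinB : Module.finrank ℚ B.endAlgebra = B.dim ^ 2) (hZB : Module.finrank ℚ (Subalgebra.center ℚ B.endAlgebra) = 1)
    (hcm : IsOfCMType Z) (hXBZ : IsIsogenous X ((B.powSucc m).prod Z)) :
    haveI := BettiUniverse.finite hX 1
    haveI := BettiUniverse.finite (AbelianVariety.isSmoothProjective_holds (A := Z)) 1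
    Module.finrank ℚ (BettiUniverse.hodge exists_isReal_hodgeModel_holds hX 1).hodgeLie =
      3 + Module.finrank ℚ (BettiUniverse.hodge exists_isReal_hodgeModel_holds
        (AbelianVariety.isSmoothProjective_holds (A := Z)) 1).hodgeLie := by
  have hA4 : HasNoTypeIVFactor B :=
    hasNoTypeIVFactor_of_center_le_bot (le_of_eq (Subalgebra.eq_bot_of_finrank_one hZB))
  rw [finrank_hodgeLie_hodge_one_eq_add_of_isIsogenous_powSucc_prod hX (AbelianVariety.isSmoothProjective_holds (A := B))
    (AbelianVariety.isSmoothProjective_holds (A := Z)) hA4 hcm hXBZ,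
    finrank_hodgeLie_hodge_one_eq_three_of_factor hBs hB0 hB2 hBcm hfinB]

/-- **`t(X) = t(Z) + 3` for EVERY `X ∼ B^{m+1} × Z` with `B` a simple non-CM curve or QM surface and `Z` of CM type of
positive dimension** — the converse / uniqueness half of the CM-part statement of the rungs `t ≤ 6`
(`CorCM/MumfordTateRankSixCMRank`: the splitting PRODUCES such a `Z` with `t(Z) + 3 = t(X)`; here ANY CM complement has
this rank), and of the rank-one part of `t = 7`. [cite: MoonenZarhin1999LowDim, §3 Thm. (3.2)(2)]
[cite: MoonenZarhin1999LowDim, §2 (2.2)–(2.3)] [cite: Deligne1982HodgeCycles, I §3.1 and Prop. 3.4] -/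
theorem mtRank_hodge_one_eq_add_three_of_isIsogenous_powSucc_prod (hX : IsSmoothProjective n X.X)
    (hBs : B.IsSimple) (hB0 : 0 < B.dim) (hB2 : B.dim ≤ 2) (hBcm : ¬ IsOfCMType B)
    (hfinB : Module.finrank ℚ B.endAlgebra = B.dim ^ 2) (hZB : Module.finrank ℚ (Subalgebra.center ℚ B.endAlgebra) = 1)
    (hcm : IsOfCMType Z) (hZ0 : 0 < Z.dim) (hXBZ : IsIsogenous X ((B.powSucc m).prod Z)) :
    haveI := BettiUniverse.finite hX 1
    haveI := BettiUniverse.finite (AbelianVariety.isSmoothProjective_holds (A := Z)) 1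
    (BettiUniverse.hodge exists_isReal_hodgeModel_holds hX 1).mtRank =
      (BettiUniverse.hodge exists_isReal_hodgeModel_holds (AbelianVariety.isSmoothProjective_holds (A := Z)) 1).mtRank + 3 := by
  have h0 : 0 < X.dim := by
    obtain ⟨f, hf⟩ := hXBZ
    rw [dim_eq_of_isIsogeny hf, dim_prod, dim_powSucc]; positivity
  rw [mtRank_hodge_one_eq_finrank_hodgeLie_add_one hX h0,
    mtRank_hodge_one_eq_finrank_hodgeLie_add_one (AbelianVariety.isSmoothProjective_holds (A := Z)) hZ0,
    finrank_hodgeLie_hodge_one_eq_three_add_of_isIsogenous_powSucc_prod hX hBs hB0 hB2 hBcm hfinB hZB hcm hXBZ]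
  ring

omit [HodgeTensorFacts.{0, 0}] in
/-- **`X ∼ B^{m+1} × Z` with `B` not of CM type is not of CM type** (CM type passes to isogenous varieties, products and
factors: `isOfCMType_iff_of_isIsogenous`, `isOfCMType_prod_iff`, `isOfCMType_powSucc_iff`). Packaging for the ladder.
[cite: MoonenZarhin1999LowDim, §2 (2.2)–(2.3)] -/
theorem not_isOfCMType_of_isIsogenous_powSucc_prod (hBcm : ¬ IsOfCMType B) (hXBZ : IsIsogenous X ((B.powSucc m).prod Z)) :
    ¬ IsOfCMType X := fun h =>
  hBcm ((isOfCMType_powSucc_iff m).1 (isOfCMType_prod_iff.1 ((isOfCMType_iff_of_isIsogenous hXBZ).1 h)).1)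

end RankOne

end Summit.HodgeConjecture.CorCM

end
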